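import Literature.AlgebraicGeometry.HodgeTheory.RationallyNormalisedDeRhamFamily
import Literature.AlgebraicGeometry.HodgeTheory.HodgeTypeExteriorProduct
import Literature.AlgebraicGeometry.Motives.BaseChangeProofs
import Summits.HodgeConjecture.HodgeConjecture.Theses.BoundaryReadout
import HarnessLib
import Literature.AlgebraicGeometry.HodgeTheory.ConjugationChartUniqueness

/-!
# Crux `BoundaryAbsoluteness` (stmt-HodgeConjecture-15913), line `typewise_readout` — the σ-infrastructure
# stub `stub_conjugateNaturality` closed modulo ONE printed theorem (chart conjugation is canonical)

The ACTIVE skeleton `Cruxes/BoundaryAbsoluteness/Lines/typewise_readout.lean` (also `Lines/birth.lean`,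
`Lines/kernel_descent.lean`, and `Cruxes/HCOverNumberFields/Lines/birth.lean` of stmt-HodgeConjecture-1070)
registers the σ-infrastructure stub

  `stub_conjugateNaturality : ∀ ⦃m n Y X⦄, IsSmoothProjective m Y → IsSmoothProjective n X →
     ∀ g σ k c c' d', IsConjugateClass σ X k c c' → IsConjugateClass σ Y k (g^* c) d' → d' = (g^σ)^* c'`

("conjugation is natural and single-valued"). Its companion `stub_conjugate_exists` is closed modulo the
named facts (J), (G), (C) of `Literature.AlgebraicGeometry.HodgeTheory.ConjugationChartExistence`
(`Theorems/BoundaryReadoutHCOverNumberFieldsConjugateExists.lean`); those facts concern EXISTENCE only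
("Not here: uniqueness of the conjugate", loc. cit.) and cannot give naturality, which is a statement
about ALL conjugation charts (`IsConjugateClass` is an `∃` over charts, each with its own affine `Y → X`,
its own analytic models and its own natural rationally normalised de Rham family).

This file isolates the missing printed input as ONE named fact, `chartConjugation_canonical`
(Charles–Schnell §11.2.2 (11.2.2)–(11.2.3) with Grothendieck's comparison theorem: the conjugation
`α ↦ α^σ` exists canonically on the complex cohomology of smooth varieties, is `σ`-linear, natural for
pull-backs, and on a smooth affine chart is computed by conjugating a closed algebraic form — the
sentence "all charts agree and compute Charles–Schnell's `α ↦ α^σ`" of the docstring of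
`IsConjugateClass`), and PROVES from it, sorry-free:

* `ConjugationChart.conjugates_eq_of_canonical` — every chart computes the canonical conjugate;
* `isConjugateClass_unique_of_canonical` — conjugates are unique (single-valuedness);
* `conjugateNaturality_of_canonical` — the registered stub `stub_conjugateNaturality`, signature VERBATIM,
  modulo the fact;
* `isConjugateClass_map_of_canonical` — the functorial form: a conjugate `c'` of `c` on `X` pulls back to a
  conjugate `(g^σ)^* c'` of `g^* c` on `Y` as soon as `g^* c` has some conjugate;
* `boundaryAbsoluteness_of_canonical`, `boundaryAbsoluteness_of_JGC_canonical` — the CRUX BY NAME modulo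
  conjugate existence (resp. (J), (G), (C)), this fact, and the line's three σ-free statements (rational
  descent, type descent, fibre kernel inclusion: stubs 3–5 verbatim, being proved by the line's seats) —
  the composition `kernelDescent_of` + `BoundaryAbsoluteness_of` of the skeleton with stub 2 discharged
  modulo the fact. CONDITIONAL: the item stays open.

So the σ-debt of every absolute-Hodge line of the programme is now (J), (G), (C) (existence) + this fact
(uniqueness/naturality), each with a locator; nothing unnamed remains in stubs 1–2.
-/

-- Intentional: the problem-level namespace `Summit.<Summit>.<Problem>.Theorems` repeats `HodgeConjecture`.
set_option linter.dupNamespace false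

noncomputable section

namespace Summit.HodgeConjecture.HodgeConjecture.Theorems

open CategoryTheory AlgebraicGeometry
open scoped Manifold ContDiff
open Literature.AlgebraicGeometry.Motives Literature.AlgebraicGeometry.HodgeTheory
open Literature.NumberTheory.Transcendental Literature.Geometry.Kaehler

/-- **Every conjugation chart computes the canonical conjugate.** If `θ` is natural for morphisms from
smooth affines into smooth projectives and computed by charts (clauses (ii)–(iii) of
`chartConjugation_canonical`), then for a chart `D` on a smooth projective `Z` and `D.Conjugates a a'`
we have `a' = θ_Z a`: the chart's expression `ξ` gives `A'^*(θ (π^* a)) = e[ξ^σ] = A'^*((π^σ)^* a')`,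
`A'^*` is injective, `θ (π^* a) = (π^σ)^* (θ a)` by naturality, and `(π^σ)^*` is injective.
[cite: CharlesSchnell2014Notes, §11.2.2 (11.2.3)] -/
theorem ConjugationChart.conjugates_eq_of_canonical {σ : ℂ ≃+* ℂ} {k : ℕ}
    (θ : ∀ X : SchemeOver ℂ, complexBetti X k → complexBetti (conjugateVariety σ X) k)
    (hnat : ∀ ⦃n : ℕ⦄ ⦃X : SchemeOver ℂ⦄, IsSmoothProjective n X →
        ∀ ⦃Y : SchemeOver ℂ⦄ (g : Y ⟶ X),
          ((∃ m, IsSmoothProjective m Y) ∨ (_root_.AlgebraicGeometry.IsAffine Y.left ∧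
            ∃ m, _root_.AlgebraicGeometry.SmoothOfRelativeDimension m Y.hom)) →
          ∀ c : complexBetti X k, θ Y (complexBetti.map g k c) = complexBetti.map (conjHom σ g) k (θ X c))
    (hchart : ∀ (E : Type) [NormedAddCommGroup E] [NormedSpace ℂ E] [FiniteDimensional ℂ E]
        (e : ComplexDeRhamIsoFamily E), e.IsNatural → IsRationalDeRhamFamily e k →
        ∀ (m : ℕ) (Y : SchemeOver ℂ) [_root_.AlgebraicGeometry.IsAffine Y.left]
          [_root_.AlgebraicGeometry.SmoothOfRelativeDimension m Y.hom]
          (A : AnalyticModel E m Y) (A' : AnalyticModel E m (conjugateVariety σ Y))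
          (ξ : AlgFormExpr Y k) (hξ : ξ.realize A ∈ cclosedSmoothForms E A.carrier k)
          (hξ' : (ξ.conj σ).realize A' ∈ cclosedSmoothForms E A'.carrier k) (c : complexBetti Y k),
          A.pullback k c = e A.carrier k (complexDeRhamCohomology.mk E A.carrier k ⟨_, hξ⟩) →
          A'.pullback k (θ Y c) =
            e A'.carrier k (complexDeRhamCohomology.mk E A'.carrier k ⟨_, hξ'⟩))
    {n : ℕ} {Z : SchemeOver ℂ} (hZ : IsSmoothProjective n Z) (D : ConjugationChart σ Z k)
    {a : complexBetti Z k} {a' : complexBetti (conjugateVariety σ Z) k} (h : D.Conjugates a a') :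
    a' = θ Z a := by
  obtain ⟨ξ, hξ, hξ', h₁, h₂⟩ := h
  -- the chart computes `θ` on the affine `D.Y`
  have hθ : D.anConj.pullback k (θ D.Y (complexBetti.map D.π k a)) =
      D.anConj.pullback k (complexBetti.map (conjHom σ D.π) k a') := by
    rw [h₂]
    exact hchart D.E D.deRham D.deRham_isNatural D.deRham_isRational D.m D.Y D.an D.anConj ξ hξ hξ'
      (complexBetti.map D.π k a) h₁
  have hθ' : θ D.Y (complexBetti.map D.π k a) = complexBetti.map (conjHom σ D.π) k a' :=
    D.anConj.pullback_injective k hθ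
  -- naturality along `π : D.Y ⟶ Z` (smooth affine into smooth projective)
  rw [hnat hZ D.π (Or.inr ⟨D.isAffine, D.m, D.smooth⟩)] at hθ'
  exact (D.injective_map hθ').symm

/-- **Conjugates are unique** (single-valuedness of `IsConjugateClass` on a smooth projective variety),
granted `chartConjugation_canonical`: two conjugates of one class, in any two charts, coincide (both are
the canonical conjugate). [cite: CharlesSchnell2014Notes, §11.2.2 (11.2.3)] -/
theorem isConjugateClass_unique_of_canonical (hN : Literature.AlgebraicGeometry.HodgeTheory.chartConjugation_canonical) {n : ℕ}
    {X : SchemeOver ℂ} (hX : IsSmoothProjective n X) {σ : ℂ ≃+* ℂ} {k : ℕ} {c : complexBetti X k}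
    {c₁ c₂ : complexBetti (conjugateVariety σ X) k} (h₁ : IsConjugateClass σ X k c c₁)
    (h₂ : IsConjugateClass σ X k c c₂) : c₁ = c₂ := by
  obtain ⟨θ, -, hnat, hchart⟩ := hN σ k
  obtain ⟨D₁, hD₁⟩ := h₁
  obtain ⟨D₂, hD₂⟩ := h₂
  rw [ConjugationChart.conjugates_eq_of_canonical θ hnat hchart hX D₁ hD₁,
    ConjugationChart.conjugates_eq_of_canonical θ hnat hchart hX D₂ hD₂]

/-- **The registered stub `stub_conjugateNaturality`, modulo `chartConjugation_canonical`** — conjugation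
commutes with pull-backs along morphisms of smooth projective varieties and is single-valued: if `c'` is
a conjugate of `c` on `X` and `d'` a conjugate of `g^* c` on `Y`, then `d' = (g^σ)^* c'`
(`d' = θ_Y (g^* c) = (g^σ)^* θ_X c = (g^σ)^* c'`). Signature verbatim the stub of
`Cruxes/BoundaryAbsoluteness/Lines/typewise_readout.lean` (= `Lines/birth.lean`,
`Cruxes/HCOverNumberFields/Lines/birth.lean`) with the fact as the only extra hypothesis.
[cite: CharlesSchnell2014Notes, §11.2.2 (11.2.2)–(11.2.3)] [cite: Grothendieck1966, Thm. 1'] -/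
theorem conjugateNaturality_of_canonical (hN : Literature.AlgebraicGeometry.HodgeTheory.chartConjugation_canonical) :
    ∀ ⦃m n : ℕ⦄ ⦃Y X : SchemeOver ℂ⦄, IsSmoothProjective m Y → IsSmoothProjective n X →
      ∀ (g : Y ⟶ X) (σ : ℂ ≃+* ℂ) (k : ℕ) (c : complexBetti X k)
        (c' : complexBetti (conjugateVariety σ X) k) (d' : complexBetti (conjugateVariety σ Y) k),
        IsConjugateClass σ X k c c' → IsConjugateClass σ Y k (complexBetti.map g k c) d' →
          d' = complexBetti.map (conjHom σ g) k c' := by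
  intro m n Y X hY hX g σ k c c' d' hc' hd'
  obtain ⟨θ, -, hnat, hchart⟩ := hN σ k
  obtain ⟨D, hD⟩ := hc'
  obtain ⟨D', hD'⟩ := hd'
  rw [ConjugationChart.conjugates_eq_of_canonical θ hnat hchart hX D hD,
    ConjugationChart.conjugates_eq_of_canonical θ hnat hchart hY D' hD']
  exact hnat hX g (Or.inl ⟨m, hY⟩) c

/-- **Functorial form.** Granted `chartConjugation_canonical`: for `g : Y ⟶ X` between smooth projective
varieties, a conjugate `c'` of `c` on `X` pulls back to a conjugate of `g^* c` on `Y`,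
`IsConjugateClass σ Y k (g^* c) ((g^σ)^* c')`, as soon as `g^* c` has some conjugate (existence is the
companion stub; e.g. from (J), (G), (C) via `exists_isConjugateClass_of_facts`).
[cite: CharlesSchnell2014Notes, §11.2.2 (11.2.2)–(11.2.3)] -/
theorem isConjugateClass_map_of_canonical (hN : Literature.AlgebraicGeometry.HodgeTheory.chartConjugation_canonical) {m n : ℕ}
    {Y X : SchemeOver ℂ} (hY : IsSmoothProjective m Y) (hX : IsSmoothProjective n X) (g : Y ⟶ X)
    {σ : ℂ ≃+* ℂ} {k : ℕ} {c : complexBetti X k} {c' : complexBetti (conjugateVariety σ X) k}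
    (hc' : IsConjugateClass σ X k c c') (hex : ∃ d', IsConjugateClass σ Y k (complexBetti.map g k c) d') :
    IsConjugateClass σ Y k (complexBetti.map g k c) (complexBetti.map (conjHom σ g) k c') := by
  obtain ⟨d', hd'⟩ := hex
  rwa [← conjugateNaturality_of_canonical hN hY hX g σ k c c' d' hc' hd']

/-! ### The crux modulo the two σ-facts and the three σ-free statements of the line

The composition of `Cruxes/BoundaryAbsoluteness/Lines/typewise_readout.lean` (`kernelDescent_of` +
`BoundaryAbsoluteness_of`, sorry-free there) with STUB 2 replaced by `conjugateNaturality_of_canonical`: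
the crux follows from conjugate EXISTENCE (stub 1; e.g. (J), (G), (C)), `chartConjugation_canonical`,
and the three σ-free statements RATIONAL DESCENT, TYPE DESCENT, FIBRE KERNEL INCLUSION (stubs 3–5 of the
line, being proved unconditionally by the line's seats), taken here as hypotheses VERBATIM. -/

/-- **`BoundaryAbsoluteness` from conjugate existence, `chartConjugation_canonical`, and the line's three
σ-free statements** (rational descent, type descent, fibre kernel inclusion — hypotheses verbatim the
registered stubs 3–5 of `Lines/typewise_readout.lean`). Proof = the line's `kernelDescent_of` and
`BoundaryAbsoluteness_of` with naturality supplied by `conjugateNaturality_of_canonical`: for a conjugate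
`c'` of `ι_t^* ξ`, name a conjugate `Ξ'` of `ξ` on `𝒳^σ`, untwist `Θ := (2πi/σ(2πi))^{-p} Ξ'`; by
naturality `c' = (ι_t^σ)^* Ξ'` and `Θ` restricts on the conjugate pieces to the rational `(p,p)` classes
given by absoluteness of `ξ|Y_i`; the kernel inclusion on `𝒳^σ` (fibre kernel inclusion) lets
rationality and type descend to `(ι_t^σ)^* Θ`. CONDITIONAL (named facts + three open statements).
[cite: CharlesSchnell2014Notes, Def. 11.2.3 and §11.2.2] [cite: Deligne1982HodgeCycles, §2 Thm. 2.12]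
[cite: DeligneHodgeIII1974, Prop. 8.2.7] -/
theorem boundaryAbsoluteness_of_canonical
    (h₁ : ∀ ⦃n : ℕ⦄ ⦃X : SchemeOver ℂ⦄, IsSmoothProjective n X →
      ∀ (σ : ℂ ≃+* ℂ) (k : ℕ) (c : complexBetti X k), ∃ c', IsConjugateClass σ X k c c')
    (hN : Literature.AlgebraicGeometry.HodgeTheory.chartConjugation_canonical)
    (h₃ : ∀ ⦃n : ℕ⦄ ⦃X : SchemeOver ℂ⦄, IsSmoothProjective n X →
      ∀ ⦃ι : Type⦄ [Finite ι] ⦃m : ι → ℕ⦄ ⦃Y : ι → SchemeOver ℂ⦄ (h : ∀ i, Y i ⟶ X),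
        (∀ i, IsSmoothProjective (m i) (Y i)) →
        ∀ ⦃nW : ℕ⦄ ⦃W : SchemeOver ℂ⦄ (w : W ⟶ X), IsSmoothProjective nW W →
          ∀ (k : ℕ), (∀ x : complexBetti X k,
              (∀ i, complexBetti.map (h i) k x = 0) → complexBetti.map w k x = 0) →
            ∀ (Θ : complexBetti X k), (∀ i, IsRationalClass (complexBetti.map (h i) k Θ)) →
              IsRationalClass (complexBetti.map w k Θ))
    (h₄ : ∀ ⦃n : ℕ⦄ ⦃X : SchemeOver ℂ⦄, IsSmoothProjective n X →
      ∀ ⦃ι : Type⦄ [Finite ι] ⦃m : ι → ℕ⦄ ⦃Y : ι → SchemeOver ℂ⦄ (h : ∀ i, Y i ⟶ X),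
        (∀ i, IsSmoothProjective (m i) (Y i)) →
        ∀ ⦃nW : ℕ⦄ ⦃W : SchemeOver ℂ⦄ (w : W ⟶ X), IsSmoothProjective nW W →
          ∀ (k a b : ℕ), (∀ x : complexBetti X k,
              (∀ i, complexBetti.map (h i) k x = 0) → complexBetti.map w k x = 0) →
            ∀ (Θ : complexBetti X k),
              (∀ i, IsOfHodgeType (m i) (Y i) k a b (complexBetti.map (h i) k Θ)) →
              IsOfHodgeType nW W k a b (complexBetti.map w k Θ))
    (h₅ : ∀ ⦃N : ℕ⦄ ⦃𝒳 C : SchemeOver ℂ⦄ (f : 𝒳 ⟶ C) (o : AlgPoints C ℂ),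
      IsSmoothProjective N 𝒳 → IsSmoothProjective 1 C → Function.Surjective f.left.base →
      ∀ ⦃ι : Type⦄ [Finite ι] ⦃m : ι → ℕ⦄ ⦃Y : ι → SchemeOver ℂ⦄ (g : ∀ i, Y i ⟶ fiberOver f o),
        (∀ i, IsSmoothProjective (m i) (Y i)) →
        (∀ x : ↥(fiberOver f o).left, ∃ (i : ι) (y : ↥(Y i).left), (g i).left.base y = x) →
        ∀ (σ : ℂ ≃+* ℂ) (k : ℕ) (x : complexBetti (conjugateVariety σ 𝒳) k),
          (∀ i, complexBetti.map (conjHom σ (g i ≫ fiberι f o)) k x = 0) →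
          ∀ (t : AlgPoints C ℂ) ⦃n : ℕ⦄, IsSmoothProjective n (fiberOver f t) →
            complexBetti.map (conjHom σ (fiberι f t)) k x = 0) :
    Summit.HodgeConjecture.HodgeConjecture.Theses.BoundaryReadout.BoundaryAbsoluteness := by
  have h₂ := conjugateNaturality_of_canonical hN
  intro N p 𝒳 C f o h𝒳 hC hf ι _ m Y g hY hcov ξ hξr hξh habs t nW ht
  -- notation of the line's `kernelDescent_of`: `X := 𝒳`, `h i := g i ≫ ι_o`, `w := ι_t`
  set h : ∀ i, Y i ⟶ 𝒳 := fun i => g i ≫ fiberι f o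
  set w : fiberOver f t ⟶ 𝒳 := fiberι f t
  have hker : ∀ (σ : ℂ ≃+* ℂ) (k : ℕ) (x : complexBetti (conjugateVariety σ 𝒳) k),
      (∀ i, complexBetti.map (conjHom σ (h i)) k x = 0) → complexBetti.map (conjHom σ w) k x = 0 :=
    fun σ k x hx => h₅ f o h𝒳 hC hf g hY hcov σ k x hx t ht
  -- the `(p,p)` type of `w^* ξ` (pull-backs preserve Hodge types)
  have hpp : IsOfHodgeType nW (fiberOver f t) (2 * p) p p (complexBetti.map w (2 * p) ξ) :=
    hξh.map_of_isSmoothProjective ht h𝒳 w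
  refine ⟨hξr.pullback _, hpp, fun σ => ⟨h₁ ht σ (2 * p) _, fun c' hc' => ?_⟩⟩
  -- a conjugate `Ξ'` of `ξ` on `𝒳^σ`; by naturality the given conjugate of `w^* ξ` is its pull-back
  obtain ⟨Ξ', hΞ'⟩ := h₁ h𝒳 σ (2 * p) ξ
  have hc'eq : c' = complexBetti.map (conjHom σ w) (2 * p) Ξ' := h₂ ht h𝒳 w σ (2 * p) ξ Ξ' c' hΞ' hc'
  -- the untwisted conjugate
  obtain ⟨Θ, hΘ⟩ : ∃ Θ : complexBetti (conjugateVariety σ 𝒳) (2 * p), Θ = (periodTwist σ p)⁻¹ • Ξ' :=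
    ⟨_, rfl⟩
  have htw : periodTwist σ p ≠ 0 := periodTwist_ne_zero σ p
  -- `Θ` restricts on every conjugate piece to the RATIONAL `(p,p)`-class `β_i`
  have hΘY : ∀ i, IsRationalClass (complexBetti.map (conjHom σ (h i)) (2 * p) Θ) ∧
      IsOfHodgeType (m i) (conjugateVariety σ (Y i)) (2 * p) p p
        (complexBetti.map (conjHom σ (h i)) (2 * p) Θ) := by
    intro i
    obtain ⟨d, hd⟩ := ((habs i).2.2 σ).1
    obtain ⟨βi, hβi, hβiH, hdβ⟩ := ((habs i).2.2 σ).2 d hd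
    have hdΞ : d = complexBetti.map (conjHom σ (h i)) (2 * p) Ξ' :=
      h₂ (hY i) h𝒳 (h i) σ (2 * p) ξ Ξ' d hΞ' hd
    have hΘi : complexBetti.map (conjHom σ (h i)) (2 * p) Θ = βi := by
      rw [hΘ, map_smul, ← hdΞ, hdβ, smul_smul, inv_mul_cancel₀ htw, one_smul]
    rw [hΘi]
    exact ⟨hβi, hβiH⟩
  -- the conjugate varieties are smooth projective
  have h𝒳' : IsSmoothProjective N (conjugateVariety σ 𝒳) := IsSmoothProjective.conjugateVariety_holds σ h𝒳
  have hY' : ∀ i, IsSmoothProjective (m i) (conjugateVariety σ (Y i)) := fun i =>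
    IsSmoothProjective.conjugateVariety_holds σ (hY i)
  have hW' : IsSmoothProjective nW (conjugateVariety σ (fiberOver f t)) :=
    IsSmoothProjective.conjugateVariety_holds σ ht
  -- descent along the kernel inclusion on `𝒳^σ`: rationality and type
  have hβ : IsRationalClass (complexBetti.map (conjHom σ w) (2 * p) Θ) :=
    h₃ h𝒳' (fun i => conjHom σ (h i)) hY' (conjHom σ w) hW' (2 * p) (hker σ (2 * p)) Θ
      (fun i => (hΘY i).1)
  have hβH : IsOfHodgeType nW (conjugateVariety σ (fiberOver f t)) (2 * p) p p
      (complexBetti.map (conjHom σ w) (2 * p) Θ) :=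
    h₄ h𝒳' (fun i => conjHom σ (h i)) hY' (conjHom σ w) hW' (2 * p) p p (hker σ (2 * p)) Θ
      (fun i => (hΘY i).2)
  have hc'β : c' = periodTwist σ p • complexBetti.map (conjHom σ w) (2 * p) Θ := by
    rw [hc'eq, hΘ, map_smul, smul_smul, mul_inv_cancel₀ htw, one_smul]
  exact ⟨_, hβ, hβH, hc'β⟩

/-- **`BoundaryAbsoluteness` modulo (J), (G), (C), `chartConjugation_canonical` and the three σ-free
statements of the line** — conjugate existence discharged by
`exists_isConjugateClass_of_facts'` ((R) is a theorem). This is the crux's trust base once the line's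
stubs 3–5 land: four Literature facts with locators. CONDITIONAL.
[cite: CharlesSchnell2014Notes, §11.2.2 and Def. 11.2.3] [cite: Jouanolou1973, Lemme 1.5]
[cite: Grothendieck1966, Thm. 1'] -/
theorem boundaryAbsoluteness_of_JGC_canonical (hJ : jouanolou_cohomologyChart)
    (hG : grothendieck_comparison_realize_surjective) (hC : conj_realize_mem_cclosedSmoothForms)
    (hN : Literature.AlgebraicGeometry.HodgeTheory.chartConjugation_canonical)
    (h₃ : ∀ ⦃n : ℕ⦄ ⦃X : SchemeOver ℂ⦄, IsSmoothProjective n X →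
      ∀ ⦃ι : Type⦄ [Finite ι] ⦃m : ι → ℕ⦄ ⦃Y : ι → SchemeOver ℂ⦄ (h : ∀ i, Y i ⟶ X),
        (∀ i, IsSmoothProjective (m i) (Y i)) →
        ∀ ⦃nW : ℕ⦄ ⦃W : SchemeOver ℂ⦄ (w : W ⟶ X), IsSmoothProjective nW W →
          ∀ (k : ℕ), (∀ x : complexBetti X k,
              (∀ i, complexBetti.map (h i) k x = 0) → complexBetti.map w k x = 0) →
            ∀ (Θ : complexBetti X k), (∀ i, IsRationalClass (complexBetti.map (h i) k Θ)) →
              IsRationalClass (complexBetti.map w k Θ))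
    (h₄ : ∀ ⦃n : ℕ⦄ ⦃X : SchemeOver ℂ⦄, IsSmoothProjective n X →
      ∀ ⦃ι : Type⦄ [Finite ι] ⦃m : ι → ℕ⦄ ⦃Y : ι → SchemeOver ℂ⦄ (h : ∀ i, Y i ⟶ X),
        (∀ i, IsSmoothProjective (m i) (Y i)) →
        ∀ ⦃nW : ℕ⦄ ⦃W : SchemeOver ℂ⦄ (w : W ⟶ X), IsSmoothProjective nW W →
          ∀ (k a b : ℕ), (∀ x : complexBetti X k,
              (∀ i, complexBetti.map (h i) k x = 0) → complexBetti.map w k x = 0) →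
            ∀ (Θ : complexBetti X k),
              (∀ i, IsOfHodgeType (m i) (Y i) k a b (complexBetti.map (h i) k Θ)) →
              IsOfHodgeType nW W k a b (complexBetti.map w k Θ))
    (h₅ : ∀ ⦃N : ℕ⦄ ⦃𝒳 C : SchemeOver ℂ⦄ (f : 𝒳 ⟶ C) (o : AlgPoints C ℂ),
      IsSmoothProjective N 𝒳 → IsSmoothProjective 1 C → Function.Surjective f.left.base →
      ∀ ⦃ι : Type⦄ [Finite ι] ⦃m : ι → ℕ⦄ ⦃Y : ι → SchemeOver ℂ⦄ (g : ∀ i, Y i ⟶ fiberOver f o),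
        (∀ i, IsSmoothProjective (m i) (Y i)) →
        (∀ x : ↥(fiberOver f o).left, ∃ (i : ι) (y : ↥(Y i).left), (g i).left.base y = x) →
        ∀ (σ : ℂ ≃+* ℂ) (k : ℕ) (x : complexBetti (conjugateVariety σ 𝒳) k),
          (∀ i, complexBetti.map (conjHom σ (g i ≫ fiberι f o)) k x = 0) →
          ∀ (t : AlgPoints C ℂ) ⦃n : ℕ⦄, IsSmoothProjective n (fiberOver f t) →
            complexBetti.map (conjHom σ (fiberι f t)) k x = 0) :
    Summit.HodgeConjecture.HodgeConjecture.Theses.BoundaryReadout.BoundaryAbsoluteness :=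
  boundaryAbsoluteness_of_canonical (exists_isConjugateClass_of_facts' hJ hG hC) hN h₃ h₄ h₅

end Summit.HodgeConjecture.HodgeConjecture.Theorems

end
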